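import Summits.AtomisticToContinuum.HydrodynamicLimit.Theorems.GibbsLightCone.Negative.IdealGas

/-!
# The hot seam of `GibbsLightCone` is load-bearing on collisions: hot-flight damping fails for free flight

Negative knowledge for the crux `RelayRaceLocality.GibbsLightCone` (stmt-AtomisticToContinuum-12501), line
`Sketch`, skeleton revision 14 (lead c4). After revision 14 the crux is reduced, sorry-free in the tree, to two
multi-time seams; the hot one, `stub_tiltedSlabContactNecklaceBound` (Y″), contains at `n = 0` (one tagged
particle, no link) the HOT-FLIGHT DAMPING statement: the hot path length
`H = ∫_0^{M τ_N} ‖v_p(u)‖ 𝟙{A√θ < ‖v_p(u)‖} du` of a tagged particle over a window of `M` mean free times has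
an exponential tail at rate `η / ℓ_N` with only an `e^{O(M)}` prefactor,
`G_N{y ℓ_N < H} ≤ C₂ e^{c₂ M} e^{-η y}` (`ℓ_N = (N+1)^{-1/3}/σ²`, `τ_N = ℓ_N/√θ`, constants before `K, σ`,
`1 ≤ M ≤ K log(N+2)`, eventually in `N`).

`HotFlightDampingWithoutPosDiameter` is that statement with the hypothesis `0 < σ` DELETED, so `σ = -1`
(negative diameters, no collisions, FREE FLIGHT `idealGasFlow`) must be covered — and then it is FALSE
(`hotFlightDamping_false_without_posDiameter`): under free flight the speed of the tagged particle is frozen,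
`H = M ℓ_N ‖v_p‖` on `{A√θ < ‖v_p‖}`, so with `y = M A' k` (`A' = max A 1`, `k` so large that
`η A' k ≥ c₂ + 1`) the event contains `{A' k √θ < ‖v_p‖}`, of FIXED positive Gaussian probability
(`localGibbsLaw_vel_apply`, `gaussMeasure_pos_of_isOpen`), while the claimed bound is
`C₂ e^{(c₂ - η A' k) M} ≤ C₂ e^{-M} = C₂/(N+2)` along `M = log(N+2)`: contradiction for large `N`. No
quantitative Gaussian tail is needed — only positivity and `M → ∞`, which the log window allows.

Moral for provers and planners: stationarity + one-time (Maxwellian) marginals cannot prove the hot seam —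
its `n = 0` slice already prices the SURVIVAL of a hot particle (`P_G(no collision over path length x ℓ_N) ≤
e^{-c x}`-type damping), a dynamical statement for the deterministic flow under the invariant law; this is
the hot half of the line's residue (evidence `Lines/Sketch-c4.md`, `Y0_scratch.lean`), the companion of
`gibbsLightCone_false_without_posDiameter` for the crux itself. prover-line-stmt-AtomisticToContinuum-12501-c4-0.
-/

noncomputable section

namespace Summit.AtomisticToContinuum.HydrodynamicLimit.Theorems

open MeasureTheory Filter Set
open scoped ENNReal Topology
open Literature.MathematicalPhysics.KineticTheory Literature.Analysis.FluidPDE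

/-- HOT-FLIGHT DAMPING WITHOUT `0 < σ`: the `n = 0` slice of the hot seam Y″ of line `Sketch`
(one tagged particle `p`, window `[0, M τ_N]`, hot threshold `A√θ`, rate `η/ℓ_N`, prefactor `C₂ e^{c₂ M}`),
with the hypothesis `0 < σ` deleted (so the free-flight gas at `σ = -1` must be covered). A refuted junk
variant (negative knowledge, NOT a literature fact): see `hotFlightDamping_false_without_posDiameter`. -/
def HotFlightDampingWithoutPosDiameter : Prop :=
  ∀ a θ : ℝ, 0 < a → 0 < θ → ∃ σ₀ : ℝ, 0 < σ₀ ∧ ∃ A η c₂ C₂ : ℝ, 0 ≤ A ∧ 0 < η ∧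
    ∀ K : ℝ, 0 < K → ∀ σ : ℝ, σ < σ₀ →
    ∀ Φ : (N : ℕ) → HardSphereFlow (Torus.geometry (Fin 3)) (hsDiameter σ N) (N + 1),
    ∀ᶠ N : ℕ in atTop, ∀ M : ℝ, 1 ≤ M → M ≤ K * Real.log ((N : ℝ) + 2) → ∀ p : Fin (N + 1), ∀ y : ℝ, 0 ≤ y →
      localGibbsLaw σ (fun _ => a) (fun _ => 0) (fun _ => θ) N (Φ N)
        {z | y * (((N + 1 : ℕ) : ℝ) ^ (-(1 / 3 : ℝ)) / σ ^ 2) <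
            ∫ u in (0 : ℝ)..(M * (((N + 1 : ℕ) : ℝ) ^ (-(1 / 3 : ℝ)) / σ ^ 2 / Real.sqrt θ)),
              (if A * Real.sqrt θ < ‖(((Φ N).flow u z) p).2‖ then ‖(((Φ N).flow u z) p).2‖ else 0)}
        ≤ ENNReal.ofReal (C₂ * Real.exp (c₂ * M) * Real.exp (-η * y))

open GibbsLightConeWithoutPosDiameter in
/-- **Hot-flight damping without `0 < σ` is false: free flight does not damp hot flights.** Witness:
`a = θ = 1`, `σ = -1` (`idealGasFlow`), `K = 1`, `M = log(N+2)`, `p = 0`, `y = M A' k` with `A' = max A 1` and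
`k = (c₂ + 1)/(η A') + 1`; the event contains `{A' k < ‖v₀‖}` (frozen speed: the hot-length integral is
`M ℓ_N ‖v₀‖`), of fixed positive Gaussian probability, against the bound `C₂ e^{(c₂ - η A' k) M} ≤ C₂/(N+2) → 0`.
[folklore] -/
theorem hotFlightDamping_false_without_posDiameter : ¬ HotFlightDampingWithoutPosDiameter := by
  intro h
  obtain ⟨σ₀, hσ₀, A, η, c₂, C₂, hA, hη, h⟩ := h 1 1 one_pos one_pos
  -- the ideal-gas flows at `σ = -1`
  set Φ : (N : ℕ) → HardSphereFlow (Torus.geometry (Fin 3)) (hsDiameter (-1) N) (N + 1) :=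
    fun N => idealGasFlow (hsDiameter_neg_one_neg N) (N + 1) with hΦ
  have key := h 1 one_pos (-1) (by linarith) Φ
  -- the speed threshold `A' k` with `η A' k ≥ c₂ + 1`
  set A' : ℝ := max A 1 with hA'
  have hA'1 : 1 ≤ A' := le_max_right _ _
  have hA'pos : 0 < A' := one_pos.trans_le hA'1
  have hAA' : A ≤ A' := le_max_left _ _
  set k : ℝ := (|c₂| + 1) / (η * A') + 1 with hk
  have hkpos : 0 < k := by positivity
  have hk1 : 1 ≤ k := by
    have : 0 ≤ (|c₂| + 1) / (η * A') := by positivity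
    linarith
  have hηk : c₂ + 1 ≤ η * A' * k := by
    have hηA : 0 < η * A' := mul_pos hη hA'pos
    have : η * A' * k = (|c₂| + 1) + η * A' := by
      rw [hk]; field_simp
    rw [this]
    linarith [le_abs_self c₂, hηA.le]
  -- the velocity sub-event and its fixed positive probability
  set S : Set V3 := {w | A' * k < ‖w‖} with hSdef
  have hSopen : IsOpen S := isOpen_lt continuous_const continuous_norm
  have hSne : S.Nonempty := by
    obtain ⟨u, hu⟩ := exists_ne (0 : V3)
    have hun : 0 < ‖u‖ := norm_pos_iff.2 hu
    refine ⟨((A' * k + 1) / ‖u‖) • u, ?_⟩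
    show A' * k < ‖((A' * k + 1) / ‖u‖) • u‖
    rw [norm_smul, Real.norm_eq_abs, abs_of_pos (by positivity), div_mul_cancel₀ _ hun.ne']
    linarith
  have hSmeas : MeasurableSet S := hSopen.measurableSet
  have hpos : 0 < gaussMeasure (0 : V3) 1 S := gaussMeasure_pos_of_isOpen one_pos hSopen hSne
  -- under free flight the sub-event lies in the hot-length event, for every `N`, `M ≥ 1`, with `y = M A' k`
  have hsub : ∀ (N : ℕ) (M : ℝ), 1 ≤ M →
      {z : Config (N + 1) (Fin 3) T3 | (z 0).2 ∈ S} ⊆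
      {z | M * A' * k * (((N + 1 : ℕ) : ℝ) ^ (-(1 / 3 : ℝ)) / (-1 : ℝ) ^ 2) <
          ∫ u in (0 : ℝ)..(M * (((N + 1 : ℕ) : ℝ) ^ (-(1 / 3 : ℝ)) / (-1 : ℝ) ^ 2 / Real.sqrt 1)),
            (if A * Real.sqrt 1 < ‖(((Φ N).flow u z) 0).2‖ then ‖(((Φ N).flow u z) 0).2‖ else 0)} := by
    intro N M hM z hz
    have hz' : A' * k < ‖(z 0).2‖ := hz
    set L : ℝ := ((N + 1 : ℕ) : ℝ) ^ (-(1 / 3 : ℝ)) with hL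
    have hLpos : 0 < L := Real.rpow_pos_of_pos (by positivity) _
    have hvA : A < ‖(z 0).2‖ := by
      have : A' ≤ A' * k := le_mul_of_one_le_right hA'pos.le hk1
      linarith
    -- the integrand is the constant `‖v₀‖` along the free flight
    have hint : ∀ u : ℝ, (if A * Real.sqrt 1 < ‖(((Φ N).flow u z) 0).2‖ then ‖(((Φ N).flow u z) 0).2‖
        else 0) = ‖(z 0).2‖ := by
      intro u
      have hvel : (((Φ N).flow u z) 0).2 = (z 0).2 := rfl
      rw [hvel, Real.sqrt_one, mul_one, if_pos hvA]
    show M * A' * k * (L / (-1 : ℝ) ^ 2) <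
      ∫ u in (0 : ℝ)..(M * (L / (-1 : ℝ) ^ 2 / Real.sqrt 1)),
        (if A * Real.sqrt 1 < ‖(((Φ N).flow u z) 0).2‖ then ‖(((Φ N).flow u z) 0).2‖ else 0)
    simp_rw [hint]
    rw [intervalIntegral.integral_const, smul_eq_mul, Real.sqrt_one, div_one, sub_zero]
    have h1 : ((-1 : ℝ) ^ 2) = 1 := by norm_num
    rw [h1, div_one]
    have hML : 0 < M * L := mul_pos (by linarith) hLpos
    nlinarith
  -- hence, eventually in `N`, the fixed positive probability is below `C₂ e^{-M}` at `M = log (N+2)`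
  have hev : ∀ᶠ N : ℕ in atTop, gaussMeasure (0 : V3) 1 S ≤
      ENNReal.ofReal (C₂ * Real.exp (-(Real.log ((N : ℝ) + 2)))) := by
    filter_upwards [key, eventually_ge_atTop 1] with N hN hN1
    set M : ℝ := Real.log ((N : ℝ) + 2) with hM
    have hN2 : (3 : ℝ) ≤ (N : ℝ) + 2 := by
      have : (1 : ℝ) ≤ N := by exact_mod_cast hN1
      linarith
    have hM1 : 1 ≤ M := by
      rw [hM, ← Real.log_exp 1]
      refine Real.log_le_log (Real.exp_pos 1) (le_trans ?_ hN2)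
      have := Real.exp_one_lt_d9
      linarith
    have hMpos : 0 < M := by linarith
    have hy : 0 ≤ M * A' * k := by positivity
    have hb := hN M hM1 (by rw [one_mul]) 0 (M * A' * k) hy
    have hvel := localGibbsLaw_vel_apply (σ := -1) one_pos one_pos (by norm_num) N (Φ N) 0 hSmeas
    calc gaussMeasure (0 : V3) 1 S
        = localGibbsLaw (-1) (fun _ => 1) (fun _ => 0) (fun _ => 1) N (Φ N) {z | (z 0).2 ∈ S} := hvel.symm
      _ ≤ _ := measure_mono (hsub N M hM1)
      _ ≤ ENNReal.ofReal (C₂ * Real.exp (c₂ * M) * Real.exp (-η * (M * A' * k))) := hb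
      _ ≤ ENNReal.ofReal (C₂ * Real.exp (-M)) := by
          refine ENNReal.ofReal_le_ofReal_iff'.2 ?_
          by_cases hC : 0 ≤ C₂
          · left
            rw [mul_assoc, ← Real.exp_add]
            refine mul_le_mul_of_nonneg_left (Real.exp_le_exp.2 ?_) hC
            have : c₂ * M + -η * (M * A' * k) = (c₂ - η * A' * k) * M := by ring
            rw [this]
            have hc : c₂ - η * A' * k ≤ -1 := by linarith
            nlinarith
          · right
            have hC' : C₂ < 0 := lt_of_not_ge hC
            have : C₂ * Real.exp (c₂ * M) * Real.exp (-η * (M * A' * k)) < 0 :=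
              mul_neg_of_neg_of_pos (mul_neg_of_neg_of_pos hC' (Real.exp_pos _)) (Real.exp_pos _)
            exact this.le
  -- but `C₂ e^{-log (N+2)} = C₂/(N+2) → 0`
  have hlim : Tendsto (fun N : ℕ => ENNReal.ofReal (C₂ * Real.exp (-(Real.log ((N : ℝ) + 2))))) atTop
      (𝓝 0) := by
    rw [← ENNReal.ofReal_zero]
    refine ENNReal.tendsto_ofReal ?_
    have h2 : Tendsto (fun N : ℕ => (N : ℝ) + 2) atTop atTop :=
      tendsto_natCast_atTop_atTop.atTop_add tendsto_const_nhds
    have h3 : Tendsto (fun N : ℕ => Real.exp (-(Real.log ((N : ℝ) + 2)))) atTop (𝓝 0) := by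
      have := Real.tendsto_exp_neg_atTop_nhds_zero.comp (Real.tendsto_log_atTop.comp h2)
      simpa [Function.comp_def] using this
    simpa using h3.const_mul C₂
  obtain ⟨N, hN, hN'⟩ := (hev.and (hlim.eventually (gt_mem_nhds hpos))).exists
  exact absurd hN (not_le.2 hN')

end Summit.AtomisticToContinuum.HydrodynamicLimit.Theorems

end
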